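import Literature.NumberTheory.LFunctions.TaoLogElliottCMization
import HarnessLib

/-!
# Tao's log-averaged Elliott theorem: the logarithmic probability measure and Lemma 2.5

First layer below the named fact `Literature.NumberTheory.LFunctions.Tao2016_theorem23_core` (Tao, Forum Math. Pi 4 (2016) e8,
the proof of Theorem 2.3 from (2.10) on).  The paper interprets the logarithmically averaged sums
probabilistically: "`𝐧`" is the random integer in `(x/ω, x]` with `ℙ(𝐧 = n) ∝ 1/n`, and all
random variables are functions of `𝐧`, so expectations are the finite weighted averages
`Literature.Tao2016.logAvg X x ω = (∑_{x/ω < n ≤ x} X(n)/n) / (∑_{x/ω < n ≤ x} 1/n)`.  We record this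
notation and PROVE the basic estimates and **Lemma 2.5** (approximate affine invariance) in
quantitative form:

* `logWeightSum x ω = ∑_{x/ω < n ≤ x} 1/n`, with the folklore harmonic-sum bounds
  `log ω - 1 ≤ logWeightSum ≤ 1 + log ω` for `1 ≤ ω ≤ x` (`log_sub_one_le_logWeightSum`,
  `logWeightSum_le`) — the quantitative form of the paper's "`∑ 1/n = (1 + o_{A→∞}(1)) log ω`";
* `logAvg`, its linearity and the bound `|𝔼 X| ≤ sup |X|`; `logCorrelation = logWeightSum · 𝔼 …`;
* `norm_sum_filter_mod_sub_le` — the change of variables `n = q n' + r` (`0 ≤ r < q`):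
  `|∑_{L<n≤U, n≡r(q)} X(n)/n - (1/q) ∑_{L<n'≤U} X(qn'+r)/n'| ≤ 8 + 2 log q` for `|X| ≤ 1`;
* `norm_sum_shift_up_sub_le` / `norm_sum_shift_down_sub_le` — translation by `+k` / `-k`:
  `|∑_{L<n≤U} X(n ± k)/n - ∑_{L<n≤U} X(n)/n| ≤ 4k` (`k ≤ L` for `-k`);
* the normalised forms `norm_logAvg_filter_mod_sub_le`, `norm_logAvg_shift_up_sub_le`,
  `norm_logAvg_shift_down_sub_le` (hypotheses: `0 < logWeightSum x ω`, and `k ≤ x/ω` for `-k`): the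
  errors are `(8 + 2 log q)/logWeightSum` and `4k/logWeightSum`, i.e. `o_{A→∞}(1)` when
  `q, k ≤ H₊` and `ω ≥ A` (the special case `0 ≤ r < q` of Lemma 2.5:
  "`𝔼(X(𝐧) 1_{𝐧 = r (q)}) = (1/q) 𝔼(X(q𝐧 + r)) + o_{A→∞}(1)`", and the translation invariance
  "`𝔼(X(𝐧 + r)) = 𝔼(X(𝐧)) + o_{A→∞}(1)`").

* `norm_logAvg_filter_modEq_sub_le`, `norm_logAvg_shift_int_sub_le` — the printed Lemma 2.5 for
  a general integer shift `r` (`𝐧 ≡ r (q)`, `X(q𝐧 + r)` with `Int.toNat`, `|r div q| ≤ x/ω`): error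
  `(8 + 2 log q + 4 |r div q|)/logWeightSum`, resp. `4|r|/logWeightSum`, obtained by composing the
  residue form (with `r mod q`) and a translation.

## References
* T. Tao, *The logarithmically averaged Chowla and Elliott conjectures for two-point
  correlations*, Forum Math. Pi 4 (2016), e8; arXiv:1509.05422, §2: the definition of `𝐧` after
  Proposition 2.4, the display `∑ 1/n = (1 + o(1)) log ω`, and Lemma 2.5 with its proof.
-/

open Finset Complex

namespace Literature.NumberTheory.LFunctions

namespace Tao2016

/-! ### The logarithmic weights -/

/-- `∑_{x/ω < n ≤ x} 1/n`, the normalising factor of the logarithmic probability measure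
("`ℙ(𝐧 = n) = (1/n) / ∑_{x/ω < n ≤ x} 1/n`"). [cite: TaoFMP2016, §2 (definition of 𝐧)] -/
noncomputable def logWeightSum (x ω : ℝ) : ℝ := ∑ n ∈ Ioc ⌊x / ω⌋₊ ⌊x⌋₊, (n : ℝ)⁻¹

/-- The weighted sum `∑_{x/ω < n ≤ x} X(n)/n`. [cite: TaoFMP2016, §2] -/
noncomputable def wsum (X : ℕ → ℂ) (x ω : ℝ) : ℂ := ∑ n ∈ Ioc ⌊x / ω⌋₊ ⌊x⌋₊, X n / (n : ℂ)

/-- The expectation `𝔼 X(𝐧) = (∑_{x/ω < n ≤ x} X(n)/n) / ∑_{x/ω < n ≤ x} 1/n` with respect to the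
logarithmic probability measure on `(x/ω, x]`. [cite: TaoFMP2016, §2 (definition of 𝐧)] -/
noncomputable def logAvg (X : ℕ → ℂ) (x ω : ℝ) : ℂ := wsum X x ω / (logWeightSum x ω : ℂ)

/-- `logWeightSum ≥ 0`. [folklore] -/
theorem logWeightSum_nonneg (x ω : ℝ) : 0 ≤ logWeightSum x ω :=
  Finset.sum_nonneg fun n _ => by positivity

/-- `∑_{x/ω < n ≤ x} 1/n ≤ 1 + log ω` for `1 ≤ ω ≤ x` (harmonic-sum estimate; the paper prints
`∑ 1/n = (1 + o(1)) log ω`). [folklore] -/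
theorem logWeightSum_le {x ω : ℝ} (hω : 1 ≤ ω) (hωx : ω ≤ x) :
    logWeightSum x ω ≤ 1 + Real.log ω := by
  have hxpos : 0 < x := by linarith
  have hxω : 0 < x / ω := div_pos hxpos (by linarith)
  unfold logWeightSum
  calc _ ≤ 1 + Real.log (x / (x / ω)) := sum_inv_Ioc_floor_le hxω (div_le_self hxpos.le hω)
    _ = 1 + Real.log ω := by rw [div_div_cancel₀ hxpos.ne']

/-- `∑_{x/ω < n ≤ x} 1/n ≥ log ω - 1` for `1 ≤ ω ≤ x` (from `1/n ≥ log(n+1) - log n`; the paper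
prints `∑ 1/n = (1 + o(1)) log ω`). [folklore] -/
theorem log_sub_one_le_logWeightSum {x ω : ℝ} (hω : 1 ≤ ω) (hωx : ω ≤ x) :
    Real.log ω - 1 ≤ logWeightSum x ω := by
  have hxpos : 0 < x := by linarith
  have hωpos : 0 < ω := by linarith
  have hxω1 : 1 ≤ x / ω := by rw [le_div_iff₀ hωpos]; linarith
  set L := ⌊x / ω⌋₊ with hL
  set U := ⌊x⌋₊ with hU
  have hL1 : 1 ≤ L := Nat.le_floor (by simpa using hxω1)
  have hLU : L ≤ U := Nat.floor_le_floor (div_le_self hxpos.le hω)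
  -- `∑_{L < n ≤ U} 1/n ≥ log (U+1) - log (L+1)`
  have key : ∀ a b : ℕ, a ≤ b →
      Real.log ((b : ℝ) + 1) - Real.log ((a : ℝ) + 1) ≤ ∑ n ∈ Ioc a b, (n : ℝ)⁻¹ := by
    intro a b hab
    induction b, hab using Nat.le_induction with
    | base => simp
    | succ b hb ih =>
      rw [Finset.sum_Ioc_succ_top (by omega)]
      have hb0 : (0 : ℝ) < (b : ℝ) + 1 := by positivity
      have h1 : Real.log ((b : ℝ) + 1 + 1) - Real.log ((b : ℝ) + 1) ≤ ((b + 1 : ℕ) : ℝ)⁻¹ := by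
        have := Real.log_le_sub_one_of_pos (show (0 : ℝ) < ((b : ℝ) + 1 + 1) / ((b : ℝ) + 1) by positivity)
        rw [Real.log_div (by positivity) hb0.ne'] at this
        push_cast
        have e : ((b : ℝ) + 1 + 1) / ((b : ℝ) + 1) - 1 = ((b : ℝ) + 1)⁻¹ := by field_simp; ring
        linarith
      push_cast at h1 ⊢
      linarith
  have h1 := key L U hLU
  -- `log (U+1) ≥ log x`, `log (L+1) ≤ log (2x/ω) = log 2 + log x - log ω`... we use `L + 1 ≤ x/ω + 1 ≤ 2x/ω`
  have hU1 : Real.log x ≤ Real.log ((U : ℝ) + 1) :=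
    Real.log_le_log hxpos (Nat.lt_floor_add_one x).le
  have hL2 : Real.log ((L : ℝ) + 1) ≤ Real.log (x / ω) + 1 := by
    have hLle : (L : ℝ) ≤ x / ω := Nat.floor_le (by positivity)
    have h2 : (L : ℝ) + 1 ≤ 2 * (x / ω) := by linarith
    calc Real.log ((L : ℝ) + 1) ≤ Real.log (2 * (x / ω)) := Real.log_le_log (by positivity) h2
      _ = Real.log 2 + Real.log (x / ω) := by rw [Real.log_mul (by norm_num) (by positivity)]
      _ ≤ Real.log (x / ω) + 1 := by
          have := Real.log_two_lt_d9; linarith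
  rw [Real.log_div hxpos.ne' hωpos.ne'] at hL2
  unfold logWeightSum
  linarith

/-- `logWeightSum > 0` for `e² ≤ ω ≤ x`. [folklore] -/
theorem logWeightSum_pos {x ω : ℝ} (hω : Real.exp 2 ≤ ω) (hωx : ω ≤ x) :
    0 < logWeightSum x ω := by
  have hω1 : 1 ≤ ω := le_trans (by linarith [Real.add_one_le_exp (2 : ℝ)]) hω
  have h2 : 2 ≤ Real.log ω := by
    rw [← Real.log_exp 2]; exact Real.log_le_log (Real.exp_pos 2) hω
  linarith [log_sub_one_le_logWeightSum hω1 hωx]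

/-! ### The expectation `𝔼` -/

/-- `wsum` is additive. [folklore] -/
theorem wsum_add (X Y : ℕ → ℂ) (x ω : ℝ) : wsum (fun n => X n + Y n) x ω = wsum X x ω + wsum Y x ω := by
  unfold wsum; rw [← Finset.sum_add_distrib]; exact Finset.sum_congr rfl fun n _ => by ring

/-- `wsum` is homogeneous. [folklore] -/
theorem wsum_const_mul (c : ℂ) (X : ℕ → ℂ) (x ω : ℝ) :
    wsum (fun n => c * X n) x ω = c * wsum X x ω := by
  unfold wsum; rw [Finset.mul_sum]; exact Finset.sum_congr rfl fun n _ => by ring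

/-- `wsum X - wsum Y = wsum (X - Y)`. [folklore] -/
theorem wsum_sub (X Y : ℕ → ℂ) (x ω : ℝ) : wsum (fun n => X n - Y n) x ω = wsum X x ω - wsum Y x ω := by
  unfold wsum; rw [← Finset.sum_sub_distrib]; exact Finset.sum_congr rfl fun n _ => by ring

/-- `|∑ X(n)/n| ≤ B ∑ 1/n` when `|X| ≤ B` on the range. [folklore] -/
theorem norm_wsum_le {X : ℕ → ℂ} {B : ℝ} (x ω : ℝ)
    (hX : ∀ n ∈ Ioc ⌊x / ω⌋₊ ⌊x⌋₊, ‖X n‖ ≤ B) : ‖wsum X x ω‖ ≤ B * logWeightSum x ω := by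
  unfold wsum logWeightSum
  rw [Finset.mul_sum]
  refine (norm_sum_le _ _).trans (Finset.sum_le_sum fun n hn => ?_)
  rw [norm_div, Complex.norm_natCast, div_eq_mul_inv]
  exact mul_le_mul_of_nonneg_right (hX n hn) (by positivity)

/-- `𝔼` is additive. [folklore] -/
theorem logAvg_add (X Y : ℕ → ℂ) (x ω : ℝ) :
    logAvg (fun n => X n + Y n) x ω = logAvg X x ω + logAvg Y x ω := by
  unfold logAvg; rw [wsum_add, add_div]

/-- `𝔼` is homogeneous. [folklore] -/
theorem logAvg_const_mul (c : ℂ) (X : ℕ → ℂ) (x ω : ℝ) :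
    logAvg (fun n => c * X n) x ω = c * logAvg X x ω := by
  unfold logAvg; rw [wsum_const_mul, mul_div_assoc]

/-- `𝔼 X - 𝔼 Y = 𝔼 (X - Y)`. [folklore] -/
theorem logAvg_sub (X Y : ℕ → ℂ) (x ω : ℝ) :
    logAvg (fun n => X n - Y n) x ω = logAvg X x ω - logAvg Y x ω := by
  unfold logAvg; rw [wsum_sub, sub_div]

/-- `|𝔼 X| ≤ B` when `|X| ≤ B` on the range (and the range is non-degenerate). [folklore] -/
theorem norm_logAvg_le {X : ℕ → ℂ} {B : ℝ} {x ω : ℝ} (hS : 0 < logWeightSum x ω)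
    (hX : ∀ n ∈ Ioc ⌊x / ω⌋₊ ⌊x⌋₊, ‖X n‖ ≤ B) : ‖logAvg X x ω‖ ≤ B := by
  unfold logAvg
  rw [norm_div, Complex.norm_real, Real.norm_of_nonneg hS.le, div_le_iff₀ hS]
  exact norm_wsum_le x ω hX

/-- `|𝔼 X - 𝔼 Y| ≤ |wsum X - wsum Y| / logWeightSum`: normalising an error. [folklore] -/
theorem norm_logAvg_sub_le {X Y : ℕ → ℂ} {x ω E : ℝ} (hS : 0 < logWeightSum x ω)
    (h : ‖wsum X x ω - wsum Y x ω‖ ≤ E) :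
    ‖logAvg X x ω - logAvg Y x ω‖ ≤ E / logWeightSum x ω := by
  unfold logAvg
  rw [← sub_div, norm_div, Complex.norm_real, Real.norm_of_nonneg hS.le]
  exact div_le_div_of_nonneg_right h hS.le

/-- The correlation (1.6) is `logWeightSum · 𝔼 g₁(a₁𝐧+b₁) g₂(a₂𝐧+b₂)` ("We conclude from (2.8)
that `|𝔼 g₁(a𝐧+b) g₂(a𝐧+b+h)| ≫ ε`"). [cite: TaoFMP2016, §2 ((2.12))] -/
theorem logCorrelation_eq_logWeightSum_mul_logAvg (g₁ g₂ : ℕ → ℂ) (a₁ b₁ a₂ b₂ : ℕ) {x ω : ℝ}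
    (hS : 0 < logWeightSum x ω) :
    logCorrelation g₁ g₂ a₁ b₁ a₂ b₂ x ω
      = (logWeightSum x ω : ℂ) * logAvg (fun n => g₁ (a₁ * n + b₁) * g₂ (a₂ * n + b₂)) x ω := by
  unfold logAvg
  rw [mul_div_cancel₀ _ (by exact_mod_cast hS.ne')]
  rfl

/-! ### Lemma 2.5: the change of variables `n = q n' + r` -/

/-- Harmonic sums over a window whose endpoints have bounded ratio: for naturals `a ≤ b` with
`b ≤ M (a + 1)` (`M ≥ 1`), `∑_{a < n ≤ b} 1/n ≤ 1 + log M`. [folklore] -/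
theorem sum_inv_Ioc_le_of_le_mul {a b : ℕ} {M : ℝ} (hM : 1 ≤ M) (hb : (b : ℝ) ≤ M * (a + 1)) :
    ∑ n ∈ Ioc a b, (n : ℝ)⁻¹ ≤ 1 + Real.log M := by
  rcases le_or_gt b a with hba | hab
  · rw [Finset.Ioc_eq_empty (by omega), Finset.sum_empty]
    linarith [Real.log_nonneg hM]
  · -- split off `n = a + 1`, then compare the rest with `log`
    have ha1 : (0 : ℝ) < (a : ℝ) + 1 := by positivity
    have h1 : ∑ n ∈ Ioc a b, (n : ℝ)⁻¹ = ((a : ℝ) + 1)⁻¹ + ∑ n ∈ Ioc (a + 1) b, (n : ℝ)⁻¹ := by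
      rw [← Finset.sum_Ioc_consecutive _ (Nat.le_succ a) (by omega : a + 1 ≤ b),
        Finset.sum_Ioc_succ_top (le_refl a), Finset.Ioc_self, Finset.sum_empty, zero_add]
      push_cast; ring
    have h2 : ∑ n ∈ Ioc (a + 1) b, (n : ℝ)⁻¹ ≤ 1 + Real.log ((b : ℝ) / ((a : ℝ) + 1)) - 1 := by
      -- `sum_inv_Ioc_floor_le` with `P = a + 1`, `Q = b` gives `≤ 1 + log (b/(a+1))`; we need the
      -- sharper telescoping bound, so we redo it: `1/n ≤ log n - log (n-1)`.
      have key : ∀ c d : ℕ, 1 ≤ c → c ≤ d →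
          ∑ n ∈ Ioc c d, (n : ℝ)⁻¹ ≤ Real.log d - Real.log c := by
        intro c d hc hcd
        induction d, hcd using Nat.le_induction with
        | base => simp
        | succ d hd ih =>
          rw [Finset.sum_Ioc_succ_top (by omega)]
          have hd0 : (0 : ℝ) < d := by exact_mod_cast (show 0 < d by omega)
          have h3 : ((d + 1 : ℕ) : ℝ)⁻¹ ≤ Real.log ((d + 1 : ℕ) : ℝ) - Real.log d := by
            have := Real.log_le_sub_one_of_pos (show (0 : ℝ) < (d : ℝ) / ((d : ℝ) + 1) by positivity)
            rw [Real.log_div hd0.ne' (by positivity)] at this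
            push_cast
            have e : (d : ℝ) / ((d : ℝ) + 1) - 1 = -((d : ℝ) + 1)⁻¹ := by field_simp; ring
            linarith
          linarith
      have h4 := key (a + 1) b (by omega) (by omega)
      have hb0 : (0 : ℝ) < b := by exact_mod_cast (show 0 < b by omega)
      rw [Real.log_div hb0.ne' ha1.ne']
      push_cast at h4 ⊢
      linarith
    have hb0' : (0 : ℝ) < b := by exact_mod_cast (show 0 < b by omega)
    have h5 : Real.log ((b : ℝ) / ((a : ℝ) + 1)) ≤ Real.log M := by
      refine Real.log_le_log (div_pos hb0' ha1) ?_
      rw [div_le_iff₀ ha1]; exact hb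
    have h6 : ((a : ℝ) + 1)⁻¹ ≤ 1 := by
      rw [inv_le_one_iff₀]; right; linarith [(Nat.cast_nonneg a : (0 : ℝ) ≤ a)]
    linarith

/-- **Lemma 2.5 (special case `0 ≤ r < q`), the change of variables, unnormalised.**  For
`0 ≤ r < q` and `|X| ≤ 1`:
`|∑_{L < n ≤ U, n ≡ r (q)} X(n)/n - (1/q) ∑_{L < n' ≤ U} X(qn'+r)/n'| ≤ 8 + 2 log q`
("Making the change of variables `n = qn' + r`, noting that `1/n` is equal to `(1/q)(1/n') +
o(1/n')` …; the constraint `x/ω < qn'+r ≤ x` can be replaced with `x/ω < n' ≤ x` while incurring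
an error of … `O(log q)`"). [cite: TaoFMP2016, Lemma 2.5 (proof)] -/
theorem norm_sum_filter_mod_sub_le {X : ℕ → ℂ} (hX : ∀ n, ‖X n‖ ≤ 1) {q r : ℕ} (hq : 0 < q)
    (hr : r < q) (L U : ℕ) :
    ‖∑ n ∈ (Ioc L U).filter (fun n => n % q = r), X n / (n : ℂ)
        - (1 / (q : ℂ)) * ∑ n' ∈ Ioc L U, X (q * n' + r) / (n' : ℂ)‖ ≤ 8 + 2 * Real.log q := by
  have hq1 : (1 : ℝ) ≤ q := by exact_mod_cast hq
  have hlogq : 0 ≤ Real.log q := Real.log_nonneg hq1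
  rcases lt_or_ge U r with hUr | hrU
  · -- `U < r < q`: the residue class is empty in `(L, U]` unless ... all `n ≤ U < r` have `n % q = n ≠ r`
    have h0 : (Ioc L U).filter (fun n => n % q = r) = ∅ := by
      refine Finset.filter_false_of_mem fun n hn => ?_
      have hn := (Finset.mem_Ioc.mp hn).2
      rw [Nat.mod_eq_of_lt (by omega)]; omega
    rw [h0, Finset.sum_empty, zero_sub, norm_neg, norm_mul, norm_div, norm_one,
      Complex.norm_natCast]
    have h1 : ‖∑ n' ∈ Ioc L U, X (q * n' + r) / (n' : ℂ)‖ ≤ ∑ n' ∈ Ioc L U, (n' : ℝ)⁻¹ :=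
      (norm_sum_le _ _).trans (Finset.sum_le_sum fun n _ => norm_div_natCast_le (hX _) n)
    have h2 : ∑ n' ∈ Ioc L U, (n' : ℝ)⁻¹ ≤ 1 + Real.log q := by
      refine sum_inv_Ioc_le_of_le_mul hq1 ?_
      have : (U : ℝ) ≤ q := by exact_mod_cast (by omega : U ≤ q)
      nlinarith [(Nat.cast_nonneg L : (0 : ℝ) ≤ L)]
    calc 1 / (q : ℝ) * ‖∑ n' ∈ Ioc L U, X (q * n' + r) / (n' : ℂ)‖ ≤ 1 * (1 + Real.log q) := by
          refine mul_le_mul ?_ (h1.trans h2) (norm_nonneg _) zero_le_one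
          rw [div_le_one (by positivity)]; exact hq1
      _ ≤ 8 + 2 * Real.log q := by linarith
  -- main case `r ≤ U`
  rw [sum_filter_mod_eq_sum (fun n => X n / (n : ℂ)) hq hr hrU, sum_filter_Iic_eq _ hq]
  set L' := (L - r) / q with hL'
  set U' := (U - r) / q with hU'
  -- (a) the stray term `n' = 0`
  have ha : ‖(if L < r then X (q * 0 + r) / ((q * 0 + r : ℕ) : ℂ) else 0)‖ ≤ 1 := by
    split_ifs
    · simp only [mul_zero, zero_add]
      exact (norm_div_natCast_le (hX r) r).trans (by
        rcases Nat.eq_zero_or_pos r with h0 | h0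
        · simp [h0]
        · exact inv_le_one_of_one_le₀ (by exact_mod_cast h0))
    · simp
  -- (b) `1/(qn'+r)` versus `1/(qn')` on `(L', U']`
  have hb : ‖∑ n' ∈ Ioc L' U', X (q * n' + r) / ((q * n' + r : ℕ) : ℂ)
      - ∑ n' ∈ Ioc L' U', X (q * n' + r) * ((((q : ℝ) * n')⁻¹ : ℝ) : ℂ)‖ ≤ 2 := by
    have e : ∀ n', X (q * n' + r) / ((q * n' + r : ℕ) : ℂ)
        = X (q * n' + r) * ((((q * n' + r : ℕ) : ℝ)⁻¹ : ℝ) : ℂ) := fun n' =>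
      div_natCast_eq_mul_ofReal _ _
    simp_rw [e]
    refine (norm_sum_mul_ofReal_sub_le _ (fun n' => hX _) _ _).trans ?_
    refine le_trans (Finset.sum_le_sum fun n' hn' => ?_) (sum_inv_sq_Ioc_le_two L' U')
    exact abs_inv_linear_sub_inv_le hq hr ((Nat.zero_le _).trans_lt (Finset.mem_Ioc.mp hn').1)
  -- (c) `(1/q) ∑_{(L',U']} X(qn'+r)/n'` versus `(1/q) ∑_{(L,U]} X(qn'+r)/n'`
  have hc_id : ∑ n' ∈ Ioc L' U', X (q * n' + r) * ((((q : ℝ) * n')⁻¹ : ℝ) : ℂ)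
      = (1 / (q : ℂ)) * ∑ n' ∈ Ioc L' U', X (q * n' + r) / (n' : ℂ) := by
    rw [Finset.mul_sum]
    refine Finset.sum_congr rfl fun n' _ => ?_
    push_cast
    ring
  have hL'L : L' ≤ L := by rw [hL']; exact (Nat.div_le_self _ _).trans (Nat.sub_le _ _)
  have hU'U : U' ≤ U := by rw [hU']; exact (Nat.div_le_self _ _).trans (Nat.sub_le _ _)
  -- endpoint ratios: `L < q (L' + 2)`, `U < q (U' + 2)`
  have hLq : (L : ℝ) ≤ (2 * q) * ((L' : ℝ) + 1) := by
    have h1 : L - r < q * (L' + 1) := by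
      rw [hL']; exact Nat.lt_mul_div_succ _ hq
    have h2 : (L : ℝ) < q * (L' + 1) + q := by
      have : L < q * (L' + 1) + r := by omega
      have : (L : ℝ) < q * ((L' : ℝ) + 1) + r := by exact_mod_cast this
      have hrq : (r : ℝ) ≤ q := by exact_mod_cast hr.le
      linarith
    nlinarith [(Nat.cast_nonneg L' : (0 : ℝ) ≤ L')]
  have hUq : (U : ℝ) ≤ (2 * q) * ((U' : ℝ) + 1) := by
    have h1 : U - r < q * (U' + 1) := by
      rw [hU']; exact Nat.lt_mul_div_succ _ hq
    have h2 : (U : ℝ) < q * (U' + 1) + q := by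
      have : U < q * (U' + 1) + r := by omega
      have : (U : ℝ) < q * ((U' : ℝ) + 1) + r := by exact_mod_cast this
      have hrq : (r : ℝ) ≤ q := by exact_mod_cast hr.le
      linarith
    nlinarith [(Nat.cast_nonneg U' : (0 : ℝ) ≤ U')]
  have h2q : (1 : ℝ) ≤ 2 * q := by linarith
  have hlog2q : Real.log (2 * q) ≤ 1 + Real.log q := by
    rw [Real.log_mul (by norm_num) (by positivity)]
    have := Real.log_two_lt_d9; linarith
  have hc : ‖∑ n' ∈ Ioc L' U', X (q * n' + r) / (n' : ℂ) - ∑ n' ∈ Ioc L U, X (q * n' + r) / (n' : ℂ)‖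
      ≤ 4 + 2 * Real.log q := by
    -- the two ranges differ by `(L', L]` and `(U', U]`
    set F : ℕ → ℂ := fun n' => X (q * n' + r) / (n' : ℂ) with hF
    have hsplit1 : ∑ n' ∈ Ioc L' U', F n' = ∑ n' ∈ Ioc L' U' with n' ≤ L, F n' + ∑ n' ∈ Ioc L' U' with ¬ (n' ≤ L), F n' :=
      (Finset.sum_filter_add_sum_filter_not _ _ _).symm
    have hsplit2 : ∑ n' ∈ Ioc L U, F n' = ∑ n' ∈ Ioc L U with n' ≤ U', F n' + ∑ n' ∈ Ioc L U with ¬ (n' ≤ U'), F n' :=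
      (Finset.sum_filter_add_sum_filter_not _ _ _).symm
    -- the middle parts coincide: `(L', U'] ∩ (L, ∞) = (L, U] ∩ (-∞, U'] = (L, U']`
    have hmid : (Ioc L' U').filter (fun n' => ¬ (n' ≤ L)) = (Ioc L U).filter (fun n' => n' ≤ U') := by
      ext n'
      simp only [Finset.mem_filter, Finset.mem_Ioc, not_le]
      constructor
      · rintro ⟨⟨h1, h2⟩, h3⟩; exact ⟨⟨h3, h2.trans hU'U⟩, h2⟩
      · rintro ⟨⟨h1, h2⟩, h3⟩; exact ⟨⟨lt_of_le_of_lt hL'L h1, h3⟩, h1⟩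
    -- the two tails
    have ht1 : ‖∑ n' ∈ Ioc L' U' with n' ≤ L, F n'‖ ≤ 1 + (1 + Real.log q) := by
      calc _ ≤ ∑ n' ∈ Ioc L' U' with n' ≤ L, (n' : ℝ)⁻¹ :=
            (norm_sum_le _ _).trans (Finset.sum_le_sum fun n' _ => norm_div_natCast_le (hX _) n')
        _ ≤ ∑ n' ∈ Ioc L' L, (n' : ℝ)⁻¹ := by
            refine Finset.sum_le_sum_of_subset_of_nonneg (fun n' hn' => ?_) fun _ _ _ => by positivity
            simp only [Finset.mem_filter, Finset.mem_Ioc] at hn'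
            exact Finset.mem_Ioc.mpr ⟨hn'.1.1, hn'.2⟩
        _ ≤ 1 + Real.log (2 * q) := sum_inv_Ioc_le_of_le_mul h2q hLq
        _ ≤ 1 + (1 + Real.log q) := by linarith
    have ht2 : ‖∑ n' ∈ Ioc L U with ¬ (n' ≤ U'), F n'‖ ≤ 1 + (1 + Real.log q) := by
      calc _ ≤ ∑ n' ∈ Ioc L U with ¬ (n' ≤ U'), (n' : ℝ)⁻¹ :=
            (norm_sum_le _ _).trans (Finset.sum_le_sum fun n' _ => norm_div_natCast_le (hX _) n')
        _ ≤ ∑ n' ∈ Ioc U' U, (n' : ℝ)⁻¹ := by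
            refine Finset.sum_le_sum_of_subset_of_nonneg (fun n' hn' => ?_) fun _ _ _ => by positivity
            simp only [Finset.mem_filter, Finset.mem_Ioc, not_le] at hn'
            exact Finset.mem_Ioc.mpr ⟨hn'.2, hn'.1.2⟩
        _ ≤ 1 + Real.log (2 * q) := sum_inv_Ioc_le_of_le_mul h2q hUq
        _ ≤ 1 + (1 + Real.log q) := by linarith
    rw [hsplit1, hsplit2, hmid]
    calc ‖∑ n' ∈ Ioc L' U' with n' ≤ L, F n' + ∑ n' ∈ Ioc L U with n' ≤ U', F n'
          - (∑ n' ∈ Ioc L U with n' ≤ U', F n' + ∑ n' ∈ Ioc L U with ¬ (n' ≤ U'), F n')‖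
        = ‖∑ n' ∈ Ioc L' U' with n' ≤ L, F n' - ∑ n' ∈ Ioc L U with ¬ (n' ≤ U'), F n'‖ := by
          congr 1; ring
      _ ≤ ‖∑ n' ∈ Ioc L' U' with n' ≤ L, F n'‖ + ‖∑ n' ∈ Ioc L U with ¬ (n' ≤ U'), F n'‖ :=
          norm_sub_le _ _
      _ ≤ 4 + 2 * Real.log q := by linarith
  -- assemble
  have hq0 : ‖(1 / (q : ℂ))‖ ≤ 1 := by
    rw [norm_div, norm_one, Complex.norm_natCast, div_le_one (by positivity)]; exact hq1
  calc ‖(if L < r then X (q * 0 + r) / ((q * 0 + r : ℕ) : ℂ) else 0)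
        + ∑ n' ∈ Ioc L' U', X (q * n' + r) / ((q * n' + r : ℕ) : ℂ)
        - (1 / (q : ℂ)) * ∑ n' ∈ Ioc L U, X (q * n' + r) / (n' : ℂ)‖
      = ‖(if L < r then X (q * 0 + r) / ((q * 0 + r : ℕ) : ℂ) else 0)
        + (∑ n' ∈ Ioc L' U', X (q * n' + r) / ((q * n' + r : ℕ) : ℂ)
            - ∑ n' ∈ Ioc L' U', X (q * n' + r) * ((((q : ℝ) * n')⁻¹ : ℝ) : ℂ))
        + (1 / (q : ℂ)) * (∑ n' ∈ Ioc L' U', X (q * n' + r) / (n' : ℂ)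
            - ∑ n' ∈ Ioc L U, X (q * n' + r) / (n' : ℂ))‖ := by
          rw [hc_id]; congr 1; ring
    _ ≤ ‖(if L < r then X (q * 0 + r) / ((q * 0 + r : ℕ) : ℂ) else 0)‖
        + ‖∑ n' ∈ Ioc L' U', X (q * n' + r) / ((q * n' + r : ℕ) : ℂ)
            - ∑ n' ∈ Ioc L' U', X (q * n' + r) * ((((q : ℝ) * n')⁻¹ : ℝ) : ℂ)‖
        + ‖(1 / (q : ℂ)) * (∑ n' ∈ Ioc L' U', X (q * n' + r) / (n' : ℂ)
            - ∑ n' ∈ Ioc L U, X (q * n' + r) / (n' : ℂ))‖ := norm_add₃_le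
    _ ≤ 1 + 2 + 1 * (4 + 2 * Real.log q) := by
        refine add_le_add (add_le_add ha hb) ?_
        rw [norm_mul]
        exact mul_le_mul hq0 hc (norm_nonneg _) zero_le_one
    _ ≤ 8 + 2 * Real.log q := by linarith

/-- **Lemma 2.5 (approximate affine invariance; special case `0 ≤ r < q`), normalised**: for
`0 ≤ r < q`, `|X| ≤ 1` and a non-degenerate range,
`|𝔼(X(𝐧) 1_{𝐧 ≡ r (q)}) - (1/q) 𝔼 X(q𝐧 + r)| ≤ (8 + 2 log q) / ∑_{x/ω<n≤x} 1/n`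
(`= o_{A→∞}(1)` for `q ≤ H₊`, as `∑ 1/n ≥ log ω - 1 ≥ log A - 1`).
[cite: TaoFMP2016, Lemma 2.5] -/
theorem norm_logAvg_filter_mod_sub_le {X : ℕ → ℂ} (hX : ∀ n, ‖X n‖ ≤ 1) {q r : ℕ} (hq : 0 < q)
    (hr : r < q) {x ω : ℝ} (hS : 0 < logWeightSum x ω) :
    ‖logAvg (fun n => if n % q = r then X n else 0) x ω
        - (1 / (q : ℂ)) * logAvg (fun n => X (q * n + r)) x ω‖
      ≤ (8 + 2 * Real.log q) / logWeightSum x ω := by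
  have h := norm_sum_filter_mod_sub_le hX hq hr ⌊x / ω⌋₊ ⌊x⌋₊
  unfold logAvg
  rw [← mul_div_assoc, ← sub_div, norm_div, Complex.norm_real, Real.norm_of_nonneg hS.le]
  refine div_le_div_of_nonneg_right (le_trans (le_of_eq ?_) h) hS.le
  congr 1
  unfold wsum
  rw [Finset.sum_filter]
  congr 1
  refine Finset.sum_congr rfl fun n _ => ?_
  by_cases h1 : n % q = r <;> simp [h1]

/-! ### Lemma 2.5: translations -/

/-- **Translation by `+k`, unnormalised**: `|∑_{L<n≤U} X(n+k)/n - ∑_{L<n≤U} X(n)/n| ≤ 4k` for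
`|X| ≤ 1` (the weights `1/n` and `1/(n+k)` differ by `≤ k/n²`, and the ranges by `2k` terms).
[cite: TaoFMP2016, Lemma 2.5 (translation invariance)] -/
theorem norm_sum_shift_up_sub_le {X : ℕ → ℂ} (hX : ∀ n, ‖X n‖ ≤ 1) (k : ℕ) (L U : ℕ) :
    ‖∑ n ∈ Ioc L U, X (n + k) / (n : ℂ) - ∑ n ∈ Ioc L U, X n / (n : ℂ)‖ ≤ 4 * k := by
  have hk0 : (0 : ℝ) ≤ k := Nat.cast_nonneg k
  rcases lt_or_ge U L with hUL | hLU
  · rw [Finset.Ioc_eq_empty (by omega)]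
    simp only [Finset.sum_empty, sub_self, norm_zero]
    positivity
  -- (a) weights
  have ha : ‖∑ n ∈ Ioc L U, X (n + k) / (n : ℂ) - ∑ n ∈ Ioc L U, X (n + k) / ((n + k : ℕ) : ℂ)‖ ≤ 2 * k := by
    have e1 : ∀ n, X (n + k) / (n : ℂ) = X (n + k) * ((((n : ℝ))⁻¹ : ℝ) : ℂ) := fun n =>
      div_natCast_eq_mul_ofReal _ _
    have e2 : ∀ n, X (n + k) / ((n + k : ℕ) : ℂ) = X (n + k) * ((((n + k : ℕ) : ℝ)⁻¹ : ℝ) : ℂ) :=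
      fun n => div_natCast_eq_mul_ofReal _ _
    simp_rw [e1, e2]
    refine (norm_sum_mul_ofReal_sub_le _ (fun n => hX _) _ _).trans ?_
    calc ∑ n ∈ Ioc L U, |((n : ℝ))⁻¹ - (((n + k : ℕ) : ℝ))⁻¹| ≤ ∑ n ∈ Ioc L U, k * ((n : ℝ) ^ 2)⁻¹ := by
          refine Finset.sum_le_sum fun n hn => ?_
          have hn1' : 1 ≤ n := by have := (Finset.mem_Ioc.mp hn).1; omega
          have hn1 : (1 : ℝ) ≤ n := by exact_mod_cast hn1'
          have hn0 : (0 : ℝ) < n := by linarith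
          push_cast
          have hnk : (0 : ℝ) < n + k := by linarith
          rw [abs_of_nonneg (by rw [sub_nonneg]; exact inv_anti₀ hn0 (by linarith))]
          rw [inv_sub_inv hn0.ne' hnk.ne', div_le_iff₀ (by positivity)]
          have : (k : ℝ) * ((n : ℝ) ^ 2)⁻¹ * (n * (n + k)) = k * ((n + k) / n) := by
            field_simp
          rw [this]
          have : (1 : ℝ) ≤ (n + k) / n := by rw [le_div_iff₀ hn0]; linarith
          nlinarith
      _ = k * ∑ n ∈ Ioc L U, ((n : ℝ) ^ 2)⁻¹ := by rw [Finset.mul_sum]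
      _ ≤ k * 2 := mul_le_mul_of_nonneg_left (sum_inv_sq_Ioc_le_two L U) hk0
      _ = 2 * k := by ring
  -- (b) ranges: reindex `m = n + k`
  have hb : ∑ n ∈ Ioc L U, X (n + k) / ((n + k : ℕ) : ℂ) = ∑ m ∈ Ioc (L + k) (U + k), X m / (m : ℂ) := by
    rw [← Finset.map_add_right_Ioc, Finset.sum_map]
    rfl
  have hc : ‖∑ m ∈ Ioc (L + k) (U + k), X m / (m : ℂ) - ∑ m ∈ Ioc L U, X m / (m : ℂ)‖ ≤ 2 * k := by
    have h1 : ∑ m ∈ Ioc L (U + k), X m / (m : ℂ)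
        = ∑ m ∈ Ioc L U, X m / (m : ℂ) + ∑ m ∈ Ioc U (U + k), X m / (m : ℂ) :=
      (Finset.sum_Ioc_consecutive _ hLU (Nat.le_add_right U k)).symm
    have h2 : ∑ m ∈ Ioc L (U + k), X m / (m : ℂ)
        = ∑ m ∈ Ioc L (L + k), X m / (m : ℂ) + ∑ m ∈ Ioc (L + k) (U + k), X m / (m : ℂ) :=
      (Finset.sum_Ioc_consecutive _ (Nat.le_add_right L k) (by omega)).symm
    have htail : ∀ a : ℕ, ‖∑ m ∈ Ioc a (a + k), X m / (m : ℂ)‖ ≤ k := by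
      intro a
      calc _ ≤ ∑ m ∈ Ioc a (a + k), (1 : ℝ) := by
            refine (norm_sum_le _ _).trans (Finset.sum_le_sum fun m hm => ?_)
            refine (norm_div_natCast_le (hX m) m).trans ?_
            have : (1 : ℝ) ≤ m := by exact_mod_cast (show 1 ≤ m by have := (Finset.mem_Ioc.mp hm).1; omega)
            exact inv_le_one_of_one_le₀ this
        _ = k := by simp
    have e : ∑ m ∈ Ioc (L + k) (U + k), X m / (m : ℂ) - ∑ m ∈ Ioc L U, X m / (m : ℂ)
        = ∑ m ∈ Ioc U (U + k), X m / (m : ℂ) - ∑ m ∈ Ioc L (L + k), X m / (m : ℂ) := by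
      have := h1.symm.trans h2
      linear_combination -this
    rw [e]
    calc _ ≤ ‖∑ m ∈ Ioc U (U + k), X m / (m : ℂ)‖ + ‖∑ m ∈ Ioc L (L + k), X m / (m : ℂ)‖ := norm_sub_le _ _
      _ ≤ k + k := add_le_add (htail U) (htail L)
      _ = 2 * k := by ring
  calc _ = ‖(∑ n ∈ Ioc L U, X (n + k) / (n : ℂ) - ∑ n ∈ Ioc L U, X (n + k) / ((n + k : ℕ) : ℂ))
        + (∑ m ∈ Ioc (L + k) (U + k), X m / (m : ℂ) - ∑ m ∈ Ioc L U, X m / (m : ℂ))‖ := by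
          rw [← hb]; congr 1; ring
    _ ≤ 2 * k + 2 * k := (norm_add_le _ _).trans (add_le_add ha hc)
    _ = 4 * k := by ring

/-- **Translation by `-k`, unnormalised**: `|∑_{L<n≤U} X(n-k)/n - ∑_{L<n≤U} X(n)/n| ≤ 4k` for
`|X| ≤ 1`, `k ≤ L ≤ U`. [cite: TaoFMP2016, Lemma 2.5 (translation invariance)] -/
theorem norm_sum_shift_down_sub_le {X : ℕ → ℂ} (hX : ∀ n, ‖X n‖ ≤ 1) {k L U : ℕ} (hkL : k ≤ L)
    (hLU : L ≤ U) :
    ‖∑ n ∈ Ioc L U, X (n - k) / (n : ℂ) - ∑ n ∈ Ioc L U, X n / (n : ℂ)‖ ≤ 4 * k := by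
  have hk0 : (0 : ℝ) ≤ k := Nat.cast_nonneg k
  -- (a) weights `1/n` versus `1/(n-k)`
  have ha : ‖∑ n ∈ Ioc L U, X (n - k) / (n : ℂ) - ∑ n ∈ Ioc L U, X (n - k) / ((n - k : ℕ) : ℂ)‖ ≤ 2 * k := by
    have e1 : ∀ n, X (n - k) / (n : ℂ) = X (n - k) * ((((n : ℝ))⁻¹ : ℝ) : ℂ) := fun n =>
      div_natCast_eq_mul_ofReal _ _
    have e2 : ∀ n, X (n - k) / ((n - k : ℕ) : ℂ) = X (n - k) * ((((n - k : ℕ) : ℝ)⁻¹ : ℝ) : ℂ) :=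
      fun n => div_natCast_eq_mul_ofReal _ _
    simp_rw [e1, e2]
    refine (norm_sum_mul_ofReal_sub_le _ (fun n => hX _) _ _).trans ?_
    calc ∑ n ∈ Ioc L U, |((n : ℝ))⁻¹ - (((n - k : ℕ) : ℝ))⁻¹|
        ≤ ∑ n ∈ Ioc L U, k * ((((n - k : ℕ) : ℝ)) ^ 2)⁻¹ := by
          refine Finset.sum_le_sum fun n hn => ?_
          have hnL : L < n := (Finset.mem_Ioc.mp hn).1
          have hm1 : 1 ≤ n - k := by omega
          have hm1r : (1 : ℝ) ≤ ((n - k : ℕ) : ℝ) := by exact_mod_cast hm1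
          have hcast : (n : ℝ) = ((n - k : ℕ) : ℝ) + k := by
            rw [← Nat.cast_add, Nat.sub_add_cancel (by omega)]
          set m : ℝ := ((n - k : ℕ) : ℝ) with hm
          have hm0 : 0 < m := by linarith
          rw [hcast, abs_of_nonpos (by rw [sub_nonpos]; exact inv_anti₀ hm0 (by linarith)),
            neg_sub, inv_sub_inv hm0.ne' (by linarith : m + k ≠ 0), div_le_iff₀ (by positivity)]
          have e : (k : ℝ) * (m ^ 2)⁻¹ * (m * (m + k)) = k * ((m + k) / m) := by field_simp
          rw [show m + (k : ℝ) - m = k by ring, e]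
          have : (1 : ℝ) ≤ (m + k) / m := by rw [le_div_iff₀ hm0]; linarith
          nlinarith
      _ = k * ∑ n ∈ Ioc L U, ((((n - k : ℕ) : ℝ)) ^ 2)⁻¹ := by rw [Finset.mul_sum]
      _ = k * ∑ m ∈ Ioc (L - k) (U - k), ((m : ℝ) ^ 2)⁻¹ := by
          congr 1
          have : Ioc L U = (Ioc (L - k) (U - k)).map (addRightEmbedding k) := by
            rw [Finset.map_add_right_Ioc]; congr 1 <;> omega
          rw [this, Finset.sum_map]
          refine Finset.sum_congr rfl fun n _ => ?_
          simp
      _ ≤ k * 2 := mul_le_mul_of_nonneg_left (sum_inv_sq_Ioc_le_two _ _) hk0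
      _ = 2 * k := by ring
  -- (b) ranges: reindex `m = n - k`
  have hb : ∑ n ∈ Ioc L U, X (n - k) / ((n - k : ℕ) : ℂ) = ∑ m ∈ Ioc (L - k) (U - k), X m / (m : ℂ) := by
    have : Ioc L U = (Ioc (L - k) (U - k)).map (addRightEmbedding k) := by
      rw [Finset.map_add_right_Ioc]; congr 1 <;> omega
    rw [this, Finset.sum_map]
    refine Finset.sum_congr rfl fun n _ => ?_
    simp
  have hc : ‖∑ m ∈ Ioc (L - k) (U - k), X m / (m : ℂ) - ∑ m ∈ Ioc L U, X m / (m : ℂ)‖ ≤ 2 * k := by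
    -- compare the ranges `(L-k, U-k]` and `(L, U] = (L-k+k, U-k+k]`
    have e : ∑ m ∈ Ioc L U, X m / (m : ℂ) = ∑ m ∈ Ioc (L - k + k) (U - k + k), X m / (m : ℂ) := by
      congr 1; congr 1 <;> omega
    rw [e, ← norm_neg, neg_sub]
    set L' := L - k with hL'
    set U' := U - k with hU'
    have hLU' : L' ≤ U' := by omega
    have h1 : ∑ m ∈ Ioc L' (U' + k), X m / (m : ℂ)
        = ∑ m ∈ Ioc L' U', X m / (m : ℂ) + ∑ m ∈ Ioc U' (U' + k), X m / (m : ℂ) :=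
      (Finset.sum_Ioc_consecutive _ hLU' (Nat.le_add_right U' k)).symm
    have h2 : ∑ m ∈ Ioc L' (U' + k), X m / (m : ℂ)
        = ∑ m ∈ Ioc L' (L' + k), X m / (m : ℂ) + ∑ m ∈ Ioc (L' + k) (U' + k), X m / (m : ℂ) :=
      (Finset.sum_Ioc_consecutive _ (Nat.le_add_right L' k) (by omega)).symm
    have htail : ∀ a : ℕ, ‖∑ m ∈ Ioc a (a + k), X m / (m : ℂ)‖ ≤ k := by
      intro a
      calc _ ≤ ∑ m ∈ Ioc a (a + k), (1 : ℝ) := by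
            refine (norm_sum_le _ _).trans (Finset.sum_le_sum fun m hm => ?_)
            refine (norm_div_natCast_le (hX m) m).trans ?_
            have : (1 : ℝ) ≤ m := by exact_mod_cast (show 1 ≤ m by have := (Finset.mem_Ioc.mp hm).1; omega)
            exact inv_le_one_of_one_le₀ this
        _ = k := by simp
    have e2 : ∑ m ∈ Ioc (L' + k) (U' + k), X m / (m : ℂ) - ∑ m ∈ Ioc L' U', X m / (m : ℂ)
        = ∑ m ∈ Ioc U' (U' + k), X m / (m : ℂ) - ∑ m ∈ Ioc L' (L' + k), X m / (m : ℂ) := by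
      have := h1.symm.trans h2
      linear_combination -this
    rw [e2]
    calc _ ≤ ‖∑ m ∈ Ioc U' (U' + k), X m / (m : ℂ)‖ + ‖∑ m ∈ Ioc L' (L' + k), X m / (m : ℂ)‖ := norm_sub_le _ _
      _ ≤ k + k := add_le_add (htail U') (htail L')
      _ = 2 * k := by ring
  calc _ = ‖(∑ n ∈ Ioc L U, X (n - k) / (n : ℂ) - ∑ n ∈ Ioc L U, X (n - k) / ((n - k : ℕ) : ℂ))
        + (∑ m ∈ Ioc (L - k) (U - k), X m / (m : ℂ) - ∑ m ∈ Ioc L U, X m / (m : ℂ))‖ := by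
          rw [← hb]; congr 1; ring
    _ ≤ 2 * k + 2 * k := (norm_add_le _ _).trans (add_le_add ha hc)
    _ = 4 * k := by ring

/-- A positive `logWeightSum` forces a non-degenerate range `⌊x/ω⌋ ≤ ⌊x⌋`. [folklore] -/
theorem floor_le_floor_of_logWeightSum_pos {x ω : ℝ} (hS : 0 < logWeightSum x ω) :
    ⌊x / ω⌋₊ ≤ ⌊x⌋₊ := by
  by_contra h
  push Not at h
  unfold logWeightSum at hS
  rw [Finset.Ioc_eq_empty (by omega), Finset.sum_empty] at hS
  exact lt_irrefl _ hS

/-- **Translation invariance, normalised**: `|𝔼 X(𝐧 + k) - 𝔼 X(𝐧)| ≤ 4k / ∑_{x/ω<n≤x} 1/n`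
("`𝔼(X(𝐧+r)) = 𝔼(X(𝐧)) + o_{A→∞}(1)` for any `r = O(H₊)`"). [cite: TaoFMP2016, Lemma 2.5] -/
theorem norm_logAvg_shift_up_sub_le {X : ℕ → ℂ} (hX : ∀ n, ‖X n‖ ≤ 1) (k : ℕ) {x ω : ℝ}
    (hS : 0 < logWeightSum x ω) :
    ‖logAvg (fun n => X (n + k)) x ω - logAvg X x ω‖ ≤ 4 * k / logWeightSum x ω :=
  norm_logAvg_sub_le hS (norm_sum_shift_up_sub_le hX k _ _)

/-- **Translation invariance by `-k`, normalised**: `|𝔼 X(𝐧 - k) - 𝔼 X(𝐧)| ≤ 4k / ∑ 1/n` for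
`k ≤ x/ω` (so that `𝐧 - k ≥ 1`). [cite: TaoFMP2016, Lemma 2.5] -/
theorem norm_logAvg_shift_down_sub_le {X : ℕ → ℂ} (hX : ∀ n, ‖X n‖ ≤ 1) {k : ℕ} {x ω : ℝ}
    (hk : (k : ℝ) ≤ x / ω) (hS : 0 < logWeightSum x ω) :
    ‖logAvg (fun n => X (n - k)) x ω - logAvg X x ω‖ ≤ 4 * k / logWeightSum x ω :=
  norm_logAvg_sub_le hS (norm_sum_shift_down_sub_le hX (Nat.le_floor hk)
    (floor_le_floor_of_logWeightSum_pos hS))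

/-! ### Lemma 2.5 for a general integer shift `r` -/

/-- For naturals `n, q` (`q ≥ 1`) and an integer `r`: `n ≡ r (mod q)` iff `n % q = (r mod q)`.
[folklore] -/
theorem natCast_modEq_iff {q : ℕ} (hq : 0 < q) (n : ℕ) (r : ℤ) :
    (n : ℤ) ≡ r [ZMOD q] ↔ n % q = (r % q).toNat := by
  have hq0 : (q : ℤ) ≠ 0 := by exact_mod_cast hq.ne'
  have hr0 : 0 ≤ r % q := Int.emod_nonneg r hq0
  constructor
  · intro h
    have h1 : ((n % q : ℕ) : ℤ) = r % q := by rw [Int.natCast_mod]; exact h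
    have h2 := congrArg Int.toNat h1
    rwa [Int.toNat_natCast] at h2
  · intro h
    show (n : ℤ) % q = r % q
    rw [← Int.natCast_mod, h, Int.toNat_of_nonneg hr0]

/-- The affine map `n ↦ q n + r` written with `r = q k + r₀`, `0 ≤ r₀ < q`, `k = r div q ≥ 0`:
`(q n + r).toNat = q (n + k) + r₀`. [folklore] -/
theorem toNat_affine_of_nonneg {q : ℕ} (hq : 0 < q) (n : ℕ) {r : ℤ} (hk : 0 ≤ r / q) :
    ((q : ℤ) * n + r).toNat = q * (n + (r / q).toNat) + (r % q).toNat := by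
  have hq0 : (q : ℤ) ≠ 0 := by exact_mod_cast hq.ne'
  have hr0 : 0 ≤ r % q := Int.emod_nonneg r hq0
  have hdecomp : r = q * (r / q) + r % q := by have := Int.emod_add_mul_ediv r q; linarith
  have : (q : ℤ) * n + r = ((q * (n + (r / q).toNat) + (r % q).toNat : ℕ) : ℤ) := by
    push_cast
    rw [Int.toNat_of_nonneg hk, Int.toNat_of_nonneg hr0]
    conv_lhs => rw [hdecomp]
    ring
  rw [this, Int.toNat_natCast]

/-- The same with `k = r div q < 0`: for `n ≥ |k|`, `(q n + r).toNat = q (n - |k|) + r₀`. [folklore] -/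
theorem toNat_affine_of_neg {q : ℕ} (hq : 0 < q) {n : ℕ} {r : ℤ} (hk : r / q < 0)
    (hn : (-(r / q)).toNat ≤ n) :
    ((q : ℤ) * n + r).toNat = q * (n - (-(r / q)).toNat) + (r % q).toNat := by
  have hq0 : (q : ℤ) ≠ 0 := by exact_mod_cast hq.ne'
  have hr0 : 0 ≤ r % q := Int.emod_nonneg r hq0
  have hdecomp : r = q * (r / q) + r % q := by have := Int.emod_add_mul_ediv r q; linarith
  have hkk : ((-(r / q)).toNat : ℤ) = -(r / q) := Int.toNat_of_nonneg (by omega)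
  have : (q : ℤ) * n + r = ((q * (n - (-(r / q)).toNat) + (r % q).toNat : ℕ) : ℤ) := by
    push_cast
    rw [Nat.cast_sub hn, hkk, Int.toNat_of_nonneg hr0]
    conv_lhs => rw [hdecomp]
    ring
  rw [this, Int.toNat_natCast]

/-- **Lemma 2.5 (approximate affine invariance), general integer shift**: for `q ≥ 1`, `r ∈ ℤ`,
`|X| ≤ 1`, writing `k = r div q`: if `|k| ≤ x/ω` then
`|𝔼(X(𝐧) 1_{𝐧 ≡ r (q)}) - (1/q) 𝔼 X(q𝐧 + r)| ≤ (8 + 2 log q + 4|k|) / ∑_{x/ω<n≤x} 1/n`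
("`𝔼(X(𝐧) 1_{𝐧 = r (q)}) = (1/q) 𝔼(X(q𝐧 + r)) + o_{A→∞}(1)` for `q ≤ H₊`, `|r| ≤ H₊`": the error
is `O(H₊ / log A)`).  Composition of the residue form with `r₀ = r mod q` and a translation by
`k`. [cite: TaoFMP2016, Lemma 2.5] -/
theorem norm_logAvg_filter_modEq_sub_le {X : ℕ → ℂ} (hX : ∀ n, ‖X n‖ ≤ 1) {q : ℕ} (hq : 0 < q)
    (r : ℤ) {x ω : ℝ} (hS : 0 < logWeightSum x ω) (hk : (((r / q).natAbs : ℕ) : ℝ) ≤ x / ω) :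
    ‖logAvg (fun n => if (n : ℤ) ≡ r [ZMOD q] then X n else 0) x ω
        - (1 / (q : ℂ)) * logAvg (fun n => X (((q : ℤ) * n + r).toNat)) x ω‖
      ≤ (8 + 2 * Real.log q + 4 * (r / q).natAbs) / logWeightSum x ω := by
  set r₀ : ℕ := (r % q).toNat with hr₀
  set k : ℤ := r / q with hkdef
  have hq0 : (q : ℤ) ≠ 0 := by exact_mod_cast hq.ne'
  have hr₀q : r₀ < q := by
    have h1 : r % q < q := Int.emod_lt_of_pos r (by exact_mod_cast hq)
    have h2 : 0 ≤ r % q := Int.emod_nonneg r hq0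
    zify; rw [hr₀, Int.toNat_of_nonneg h2]; exact h1
  -- Step 1: the residue form with `r₀`, for `Y m := X (q m + r₀)`
  have hfilter : (fun n : ℕ => if (n : ℤ) ≡ r [ZMOD q] then X n else 0)
      = (fun n : ℕ => if n % q = r₀ then X n else 0) := by
    funext n
    by_cases h : (n : ℤ) ≡ r [ZMOD q]
    · have h' : n % q = r₀ := (natCast_modEq_iff hq n r).mp h
      rw [if_pos h, if_pos h']
    · have h' : ¬ (n % q = r₀) := fun h' => h ((natCast_modEq_iff hq n r).mpr h')
      rw [if_neg h, if_neg h']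
  have h1 := norm_logAvg_filter_mod_sub_le hX hq hr₀q hS (x := x) (ω := ω)
  rw [← hfilter] at h1
  -- Step 2: `X((q n + r).toNat) = Y(n ± |k|)` on the range, and the translation lemma
  set Y : ℕ → ℂ := fun m => X (q * m + r₀) with hY
  have hYb : ∀ m, ‖Y m‖ ≤ 1 := fun m => hX _
  have hq1 : (1 : ℝ) ≤ q := by exact_mod_cast hq
  have hqinv : ‖(1 / (q : ℂ))‖ ≤ 1 := by
    rw [norm_div, norm_one, Complex.norm_natCast, div_le_one (by positivity)]; exact hq1
  have h2 : ‖logAvg (fun n => X (((q : ℤ) * n + r).toNat)) x ω - logAvg Y x ω‖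
      ≤ 4 * (k.natAbs : ℝ) / logWeightSum x ω := by
    rcases le_or_gt 0 k with hk0 | hk0
    · -- `k ≥ 0`: shift up by `k.toNat = |k|`
      have hfun : (fun n : ℕ => X (((q : ℤ) * n + r).toNat)) = fun n => Y (n + k.toNat) := by
        funext n
        rw [toNat_affine_of_nonneg hq n hk0]
      have hnat : (k.natAbs : ℝ) = (k.toNat : ℝ) := by
        have : (k.natAbs : ℤ) = k.toNat := by
          rw [Int.natAbs_of_nonneg hk0, Int.toNat_of_nonneg hk0]
        exact_mod_cast this
      rw [hfun, hnat]
      exact norm_logAvg_shift_up_sub_le hYb k.toNat hS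
    · -- `k < 0`: shift down by `(-k).toNat = |k|`, valid since `|k| ≤ x/ω < 𝐧`
      have hnat : k.natAbs = (-k).toNat := by
        have : ((k.natAbs : ℕ) : ℤ) = (((-k).toNat : ℕ) : ℤ) := by
          rw [Int.natCast_natAbs, Int.toNat_of_nonneg (by linarith), abs_of_neg hk0]
        exact_mod_cast this
      have hkx : (((-k).toNat : ℕ) : ℝ) ≤ x / ω := by rw [← hnat]; exact hk
      have hL : (-k).toNat ≤ ⌊x / ω⌋₊ := Nat.le_floor hkx
      -- the two functions agree on the range `(⌊x/ω⌋, ⌊x⌋]`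
      have hwsum : wsum (fun n : ℕ => X (((q : ℤ) * n + r).toNat)) x ω
          = wsum (fun n => Y (n - (-k).toNat)) x ω := by
        unfold wsum
        refine Finset.sum_congr rfl fun n hn => ?_
        have hn' : (-k).toNat ≤ n := by have := (Finset.mem_Ioc.mp hn).1; omega
        show X (((q : ℤ) * n + r).toNat) / (n : ℂ) = Y (n - (-k).toNat) / (n : ℂ)
        rw [toNat_affine_of_neg hq hk0 hn']
      have hla : logAvg (fun n : ℕ => X (((q : ℤ) * n + r).toNat)) x ω
          = logAvg (fun n => Y (n - (-k).toNat)) x ω := by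
        unfold logAvg; rw [hwsum]
      rw [hla, hnat]
      exact norm_logAvg_shift_down_sub_le hYb hkx hS
  -- Step 3: combine
  calc ‖logAvg (fun n => if (n : ℤ) ≡ r [ZMOD q] then X n else 0) x ω
        - (1 / (q : ℂ)) * logAvg (fun n => X (((q : ℤ) * n + r).toNat)) x ω‖
      = ‖(logAvg (fun n => if (n : ℤ) ≡ r [ZMOD q] then X n else 0) x ω
          - (1 / (q : ℂ)) * logAvg Y x ω)
        - (1 / (q : ℂ)) * (logAvg (fun n => X (((q : ℤ) * n + r).toNat)) x ω - logAvg Y x ω)‖ := by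
          congr 1; ring
    _ ≤ ‖logAvg (fun n => if (n : ℤ) ≡ r [ZMOD q] then X n else 0) x ω
          - (1 / (q : ℂ)) * logAvg Y x ω‖
        + ‖(1 / (q : ℂ)) * (logAvg (fun n => X (((q : ℤ) * n + r).toNat)) x ω - logAvg Y x ω)‖ :=
          norm_sub_le _ _
    _ ≤ (8 + 2 * Real.log q) / logWeightSum x ω + 1 * (4 * (k.natAbs : ℝ) / logWeightSum x ω) := by
          refine add_le_add h1 ?_
          rw [norm_mul]
          exact mul_le_mul hqinv h2 (norm_nonneg _) zero_le_one
    _ = (8 + 2 * Real.log q + 4 * (r / q).natAbs) / logWeightSum x ω := by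
          rw [hkdef]; ring

/-- **Translation invariance, general integer shift**: `|𝔼 X(𝐧 + r) - 𝔼 X(𝐧)| ≤ 4|r| / ∑ 1/n`
for `|r| ≤ x/ω` ("`𝔼(X(𝐧+r)) = 𝔼(X(𝐧)) + o_{A→∞}(1)` for any `r = O(H₊)`").
[cite: TaoFMP2016, Lemma 2.5] -/
theorem norm_logAvg_shift_int_sub_le {X : ℕ → ℂ} (hX : ∀ n, ‖X n‖ ≤ 1) (r : ℤ) {x ω : ℝ}
    (hS : 0 < logWeightSum x ω) (hr : ((r.natAbs : ℕ) : ℝ) ≤ x / ω) :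
    ‖logAvg (fun n => X (((n : ℤ) + r).toNat)) x ω - logAvg X x ω‖
      ≤ 4 * r.natAbs / logWeightSum x ω := by
  rcases le_or_gt 0 r with hr0 | hr0
  · have hfun : (fun n : ℕ => X (((n : ℤ) + r).toNat)) = fun n => X (n + r.toNat) := by
      funext n
      congr 1
      have : (n : ℤ) + r = ((n + r.toNat : ℕ) : ℤ) := by
        push_cast; rw [Int.toNat_of_nonneg hr0]
      rw [this, Int.toNat_natCast]
    have hnat : (r.natAbs : ℝ) = (r.toNat : ℝ) := by
      have : (r.natAbs : ℤ) = r.toNat := by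
        rw [Int.natAbs_of_nonneg hr0, Int.toNat_of_nonneg hr0]
      exact_mod_cast this
    rw [hfun, hnat]
    exact norm_logAvg_shift_up_sub_le hX r.toNat hS
  · have hnat : r.natAbs = (-r).toNat := by
      have : ((r.natAbs : ℕ) : ℤ) = (((-r).toNat : ℕ) : ℤ) := by
        rw [Int.natCast_natAbs, Int.toNat_of_nonneg (by linarith), abs_of_neg hr0]
      exact_mod_cast this
    have hkx : (((-r).toNat : ℕ) : ℝ) ≤ x / ω := by rw [← hnat]; exact hr
    have hwsum : wsum (fun n : ℕ => X (((n : ℤ) + r).toNat)) x ω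
        = wsum (fun n => X (n - (-r).toNat)) x ω := by
      unfold wsum
      refine Finset.sum_congr rfl fun n hn => ?_
      have hL : (-r).toNat ≤ ⌊x / ω⌋₊ := Nat.le_floor hkx
      have hn' : (-r).toNat ≤ n := by have := (Finset.mem_Ioc.mp hn).1; omega
      show X (((n : ℤ) + r).toNat) / (n : ℂ) = X (n - (-r).toNat) / (n : ℂ)
      have : (n : ℤ) + r = ((n - (-r).toNat : ℕ) : ℤ) := by
        rw [Nat.cast_sub hn', Int.toNat_of_nonneg (by omega)]; ring
      rw [this, Int.toNat_natCast]
    have hla : logAvg (fun n : ℕ => X (((n : ℤ) + r).toNat)) x ω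
        = logAvg (fun n => X (n - (-r).toNat)) x ω := by
      unfold logAvg; rw [hwsum]
    rw [hla, hnat]
    exact norm_logAvg_shift_down_sub_le hX hkx hS

end Tao2016

end Literature.NumberTheory.LFunctions
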